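import Summits.BirchSwinnertonDyer.BirchSwinnertonDyer.Theses.TwistFamilyManinDescent
import Summits.BirchSwinnertonDyer.BirchSwinnertonDyer.Theorems.ManinLocalTwoThreeManinPrimeToAdditiveFiveLeCornersOfStrongIsUnstarred
import Literature.NumberTheory.EllipticCurves.BSDRootNumberLocalTablesProofs
import HarnessLib

/-!
# Route `ManinLocalTwoThree`, residual crux C5 `ManinPrimeToAdditiveFiveLe` (stmt-BirchSwinnertonDyer-22969), line
# `upper_anchor` (skeleton v13): **route `TwistFamilyManinDescent`'s LINE-17 item T17 `SupersingularCornerTwistTransport`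
# (stmt-BirchSwinnertonDyer-27551) is a THEOREM — outright, from its displayed antecedents K15a ∧ Ray57, WITHOUT
# Gealy–Klagsbrun — and so is its bundle form `SupersingularCornerTwistTransportOfGK` (stmt-BirchSwinnertonDyer-27665)**

Lead seat bsd-line-ml23-c5-p1 (gen 7). The two decompositions of C5 (this line's skeleton; TFMD's closed `Assembly` over
`EisensteinAdditiveManinResidual` stmt-25138) share every open leaf at `p ∈ {5, 7}` (skeleton v13). On TFMD's side the
potentially SUPERSINGULAR CORNER at `5` — the `X₀`-optimal curves with `E[5]` reducible on the rows `ord₅ Δ_min ∈ {2, 10}`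
(Kodaira II / II*, tame index `e = 6 ∤ p − 1`, where Raynaud's `e < p − 1` and Edixhoven's method are void; 771 of the
1 303 reducible corner classes with `N ≤ 5·10⁵`) — is the registered support item T17 `SupersingularCornerTwistTransport`
(stmt-27551, «provable now, L»), whose critic verdict (idea-crit-5 V#85) priced it as provable only MODULO the cite-only
orientation fact `gealyKlagsbrun2017_neronScalar_of_additive_potSupersingular` (hence the bundle item stmt-27665). THIS FILE
proves T17 from its displayed antecedents ALONE (K15a `SupersingularStrongIsUnstarred` stmt-27072, Ray57
`EisensteinRaynaudRegimeManinUnit` stmt-26325, modularity; the three printed semistable facts are carried, not used): the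
orientation is supplied by K15a on the TWISTED class, not by a Néron-scalar law, and the Manin transport is the an-cell's
irreducibility-free one-inclusion Stevens sandwich (`maninConstant_dvd_of_isIsogenous_twist_pStar_of_padicValInt_lt_six`,
θ p617000: `c(D) ∣ c(D₀)` from the UNSTARRED partner `W₀` to any lattice-optimal `W ∼ W₀ ⊗ 5*`), which needs no degree,
no flip/commute dichotomy and no `Δv`-sign.

PROOF. `W` globally minimal with a datum `D` at level `N` carrying the lattice clause, `25 ∣ N`, `W[5]` reducible,
`W ⊗ 5*` additive at `5`, `ord₅ Δ_min(W) ∈ {2, 10}`. Level = conductor (Carayol, `IsNewformOf.level_eq_conductorNorm_of_exists_isNewformOf`).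
§1: `25 ∣ N(X) ⟺ X` neither good nor multiplicative at the place `(5)` (any model; `natGenerator_sq_dvd_conductorNorm_iff` +
the local trichotomy). §2 (the partner, = the width seat's `exists_optimalPartner_pStar_of_row_two_or_ten` with the global
odd-twist-minimality binder REPLACED by «`W ⊗ p*` additive at `p`»): the lattice-optimal curve `W₀` of the class of `W ⊗ p*`
(modularity + Edixhoven Prop. 2) has `p² ∣ N(W₀) = N(W)` (conductor is an isogeny invariant granted modularity; the `p*`-pair
lemma `conductorNorm_eq_of_isIsogenous_twist_pStar_of_sq_dvd`), `W ∼ W₀ ⊗ p*`, `W₀[p]` reducible, `W₀ ⊗ p*` additive at `p`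
(it is isogenous to `W`), and `ord_p Δ_min(W₀) ∈ {4, 8}`: the globally minimal model `C` of `W ⊗ p*` has
`ord_p Δ_min(C) = ord_p Δ_min(W) + 6 − 12·ord_p u ∈ {8, 4}` (`padicValInt_minimalDiscriminantInt_twist_pStar_eq` + the
Kodaira list at an additive potentially good `p ≥ 5`), and the PROVED tame-index isogeny invariance
(`TameDefectIsogenyInvariance.gcd_padicValInt_minimalDiscriminantInt_eq_of_isIsogenous`, Serre–Tate) along `W₀ ∼ C` gives
`gcd(12, ord_p Δ_min(W₀)) = 4`. §3 (T17): `ord₅ Δ_min(W₀) = 8` is a K15a row of the OPTIMAL `W₀` — empty (`K15a ⟹ < 6`); so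
`ord₅ Δ_min(W₀) = 4`, Ray57 gives `5 ∤ c(D₀)`, and `c(D) ∣ c(D₀)` (θ, `W₀` unstarred, `D` lattice-optimal at the common
conductor) gives `5 ∤ c(D)` — for BOTH rows `2` (II, the flip twin) and `10` (II*, the commuting twin) of `W`, uniformly.

CONSEQUENCES (by name, for route `TwistFamilyManinDescent`'s pens): stmt-27551 closes `--by
Summit.BirchSwinnertonDyer.BirchSwinnertonDyer.Theorems.supersingularCornerTwistTransport_proof`; stmt-27665
(`SupersingularCornerTwistTransportOfGK` = GK → T17) closes `--by …supersingularCornerTwistTransportOfGK_proof` with GK idle;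
through the LINE-17 glue `CornerResidualOfSupersingularTransport` (stmt-27553; landed by seat bsd-line-ttd-p1 g9, p634960:
`TwistFamilyManinDescent.cornerResidualOfSupersingularTransport_proof`) the open content of Corner57 (stmt-26289) is exactly
`OrdinaryCornerManinResidual` (stmt-27552) ∪ {K15a, Ray57} (one-line corollary, left to the consumer to keep this module off that import). For C5's skeleton v13 nothing changes (its (5; II) cell was already
carried by K15a ∧ K15b); this file removes Gealy–Klagsbrun from TFMD's book as well. HONEST STATUS: T17 is an implication
between OPEN items (K15a beyond print, Ray57 ⟸ K15a ∧ K15b by the closed glue stmt-27096); nothing here proves K15a, K15b,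
Corner57, C5, Manin's conjecture or BSD.

References: [Stevens1989] Lemmas (5.2), (5.4); [EdixhovenManin1991] Prop. 2, Prop. 7, Thm. 3; [SilvermanATAEC1994] IV
Table 4.1, IV.10; [SilvermanAEC2009] VII.5 Prop. 5.1, Cor. VII.7.2; [SerreTate1968] §2 Cor. 3; [AtkinLehner1970] Thm. 4;
[Carayol1986]; [GealyKlagsbrun2017] Thm. 1 (NOT used).
-/

set_option autoImplicit false
-- the Theorems namespace of this sub repeats the summit name by design (D-0017 nested layout)
set_option linter.dupNamespace false

noncomputable section

open scoped Classical NumberField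

namespace Summit.BirchSwinnertonDyer.BirchSwinnertonDyer.Theorems

open WeierstrassCurve IsDedekindDomain IsDedekindDomain.HeightOneSpectrum Rat.HeightOneSpectrum NumberField
  Literature.NumberTheory.EllipticCurves Literature.NumberTheory.EllipticCurves.ModularForms
  Literature.NumberTheory.EllipticCurves.Rank1Residual
  Literature.NumberTheory.DiophantineGeometry
  Summit.BirchSwinnertonDyer.Rank1Residual
  Summit.BirchSwinnertonDyer.Rank1Residual.ManinAdditive
  Summit.BirchSwinnertonDyer.Rank1Residual.Additive
  Summit.BirchSwinnertonDyer.BirchSwinnertonDyer.Theses.TwistFamilyManinDescent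

/-! ## §1 `p² ∣ N(X)` ⟺ `X` is neither good nor multiplicative at the place `(p)` (any model) -/

/-- **`p² ∣ N(X)` ⟹ `X` is neither good nor multiplicative at the place `(p)` of `ℤ`** (any model of `X/ℚ`; the
conductor exponent is `≥ 2` iff the reduction is additive, Silverman ATAEC IV.10.2 (c); tree
`natGenerator_sq_dvd_conductorNorm_iff` and the local trichotomy). [cite: SilvermanATAEC1994, IV.10.2 (c)] -/
theorem not_good_or_mult_at_primesEquiv_symm_of_sq_dvd_conductorNorm (X : WeierstrassCurve ℚ) [X.IsElliptic]
    {p : ℕ} (hp : p.Prime) (hsq : p ^ 2 ∣ X.conductorNorm ℤ) :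
    ¬ (X.HasGoodReductionAt ((Rat.HeightOneSpectrum.primesEquiv (R := ℤ)).symm ⟨p, hp⟩) ∨
      X.HasMultiplicativeReductionAt ((Rat.HeightOneSpectrum.primesEquiv (R := ℤ)).symm ⟨p, hp⟩)) := by
  set v : HeightOneSpectrum ℤ := (Rat.HeightOneSpectrum.primesEquiv (R := ℤ)).symm ⟨p, hp⟩ with hv
  have hgen : natGenerator v = p :=
    congrArg Subtype.val ((Rat.HeightOneSpectrum.primesEquiv (R := ℤ)).apply_symm_apply ⟨p, hp⟩)
  have hadd : X.HasAdditiveReductionAt v := by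
    rw [← natGenerator_sq_dvd_conductorNorm_iff v X, hgen]
    exact hsq
  rintro (hg | hm)
  · exact hg.not_hasAdditiveReductionAt hadd
  · exact hm.not_hasAdditiveReductionAt hadd

/-- **`X` neither good nor multiplicative at the place `(p)` ⟹ `p² ∣ N(X)`** (any model; converse of the previous lemma,
by the local trichotomy good / multiplicative / additive). [cite: SilvermanATAEC1994, IV.10.2 (c)] -/
theorem sq_dvd_conductorNorm_of_not_good_or_mult_at_primesEquiv_symm (X : WeierstrassCurve ℚ) [X.IsElliptic]
    {p : ℕ} (hp : p.Prime)
    (h : ¬ (X.HasGoodReductionAt ((Rat.HeightOneSpectrum.primesEquiv (R := ℤ)).symm ⟨p, hp⟩) ∨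
      X.HasMultiplicativeReductionAt ((Rat.HeightOneSpectrum.primesEquiv (R := ℤ)).symm ⟨p, hp⟩))) :
    p ^ 2 ∣ X.conductorNorm ℤ := by
  set v : HeightOneSpectrum ℤ := (Rat.HeightOneSpectrum.primesEquiv (R := ℤ)).symm ⟨p, hp⟩ with hv
  have hgen : natGenerator v = p :=
    congrArg Subtype.val ((Rat.HeightOneSpectrum.primesEquiv (R := ℤ)).apply_symm_apply ⟨p, hp⟩)
  rcases hasGoodReductionAt_or_hasMultiplicativeReductionAt_or_hasAdditiveReductionAt v X with hg | hm | ha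
  · exact absurd (Or.inl hg) h
  · exact absurd (Or.inr hm) h
  · rw [← hgen, natGenerator_sq_dvd_conductorNorm_iff v X]
    exact ha

/-! ## §2 The lattice-optimal `χ_{p*}`-partner of a `W[p]`-reducible curve on the rows `(p; 2)`, `(p; 10)` with
`W ⊗ p*` additive sits on the row `(p; 4)` or `(p; 8)` — no global twist-minimality -/

/-- **The lattice-optimal `χ_{p*}`-partner on the rows `ord_p Δ_min ∈ {2, 10}`, keyed on «`W ⊗ p*` additive at `p`»**
(`p ≥ 5`, `p² ∣ N(W)`, `W[p]` reducible, modularity): a globally minimal `W₀ ∼ W ⊗ p*` with a lattice-optimal conductor-level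
datum, `W ∼ W₀ ⊗ p*`, `p² ∣ N(W₀) = N(W)`, `W₀[p]` reducible, `W₀ ⊗ p*` additive at `p`, and `ord_p Δ_min(W₀) ∈ {4, 8}`. The width
seat's `exists_optimalPartner_pStar_of_row_two_or_ten` (ψ part 1) with its odd-twist-minimality binder replaced by the local
hypothesis route `TwistFamilyManinDescent` uses; same mechanism (tame-index isogeny invariance along `W₀ ∼ C`, `C` the globally
minimal model of `W ⊗ p*`, `ord_p Δ_min(C) ∈ {8, 4}`). [cite: SilvermanATAEC1994, IV Table 4.1] [cite: SerreTate1968, §2 Cor. 3]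
[cite: EdixhovenManin1991, Prop. 2] [cite: AtkinLehner1970, Thm. 4] -/
theorem exists_optimalPartner_pStar_of_row_two_or_ten_of_twist_additive (hnf : exists_isNewformOf) {p : ℕ}
    [hpF : Fact p.Prime] (hp5 : 5 ≤ p) (W : WeierstrassCurve ℚ) [W.IsElliptic] [W.IsGloballyMinimal]
    (hpN : p ^ 2 ∣ W.conductorNorm ℤ)
    (htw : ¬ ((W.quadraticTwist (((-1 : ℤ) ^ (p / 2) * p : ℤ) : ℚ)).HasGoodReductionAt
          ((Rat.HeightOneSpectrum.primesEquiv (R := ℤ)).symm ⟨p, hpF.out⟩) ∨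
        (W.quadraticTwist (((-1 : ℤ) ^ (p / 2) * p : ℤ) : ℚ)).HasMultiplicativeReductionAt
          ((Rat.HeightOneSpectrum.primesEquiv (R := ℤ)).symm ⟨p, hpF.out⟩)))
    (hred : ¬ W.HasIrreducibleModPGaloisRep p)
    (hvW : padicValInt p W.minimalDiscriminantInt = 2 ∨ padicValInt p W.minimalDiscriminantInt = 10) :
    ∃ (W₀ : WeierstrassCurve ℚ) (_ : W₀.IsElliptic) (_ : W₀.IsGloballyMinimal) (_ : NeZero (W₀.conductorNorm ℤ))
      (D₀ : ModularParametrizationData W₀ (W₀.conductorNorm ℤ)),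
      IsLatticeOptimal D₀ ∧ IsIsogenous (W.quadraticTwist ((((-1 : ℤ) ^ (p / 2) * p : ℤ)) : ℚ)) W₀ ∧
      IsIsogenous W (W₀.quadraticTwist ((((-1 : ℤ) ^ (p / 2) * p : ℤ)) : ℚ)) ∧
      p ^ 2 ∣ W₀.conductorNorm ℤ ∧ W₀.conductorNorm ℤ = W.conductorNorm ℤ ∧
      ¬ W₀.HasIrreducibleModPGaloisRep p ∧
      ¬ ((W₀.quadraticTwist (((-1 : ℤ) ^ (p / 2) * p : ℤ) : ℚ)).HasGoodReductionAt
          ((Rat.HeightOneSpectrum.primesEquiv (R := ℤ)).symm ⟨p, hpF.out⟩) ∨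
        (W₀.quadraticTwist (((-1 : ℤ) ^ (p / 2) * p : ℤ) : ℚ)).HasMultiplicativeReductionAt
          ((Rat.HeightOneSpectrum.primesEquiv (R := ℤ)).symm ⟨p, hpF.out⟩)) ∧
      (padicValInt p W₀.minimalDiscriminantInt = 4 ∨ padicValInt p W₀.minimalDiscriminantInt = 8) := by
  have hp : p.Prime := hpF.out
  have hp2 : p ≠ 2 := by omega
  obtain ⟨hcast, hd⟩ := pStar_intCast p
  have hd0 : ((((-1 : ℤ) ^ (p / 2) * p : ℤ)) : ℚ) ≠ 0 := by
    push_cast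
    exact mul_ne_zero (pow_ne_zero _ (by norm_num)) (by exact_mod_cast hp.ne_zero)
  haveI : (W.quadraticTwist ((((-1 : ℤ) ^ (p / 2) * p : ℤ)) : ℚ)).IsElliptic := W.isElliptic_quadraticTwist hd0
  have hmod : nonempty_modularParametrizationData :=
    nonempty_modularParametrizationData_of_exists_isNewformOf hnf IsNewformOf.exists_maninConstant_ne_zero_holds
  have hadd : Addv W p := not_good_and_not_mult_of_sq_dvd_conductorNorm W hpN
  have hj : 0 ≤ padicValRat p W.j := padicValRat_j_nonneg_of_addv_of_twist_pStar_not_semistable W p hp2 hadd htw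
  -- `p² ∣ N(W ⊗ p*)` from the local hypothesis
  have hpT : p ^ 2 ∣ (W.quadraticTwist ((((-1 : ℤ) ^ (p / 2) * p : ℤ)) : ℚ)).conductorNorm ℤ :=
    sq_dvd_conductorNorm_of_not_good_or_mult_at_primesEquiv_symm _ hp htw
  -- the lattice-optimal curve `W₀` of the class of `W ⊗ p*`
  obtain ⟨W₀, hE₀, hM₀, hne₀, D₀, hD₀, hiso⟩ :=
    exists_isIsogenous_latticeOptimal hnf (W.quadraticTwist ((((-1 : ℤ) ^ (p / 2) * p : ℤ)) : ℚ))
  haveI := hE₀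
  haveI := hM₀
  haveI := hne₀
  haveI : (W₀.quadraticTwist ((((-1 : ℤ) ^ (p / 2) * p : ℤ)) : ℚ)).IsElliptic := W₀.isElliptic_quadraticTwist hd0
  haveI : ((W.quadraticTwist ((((-1 : ℤ) ^ (p / 2) * p : ℤ)) : ℚ)).quadraticTwist
      ((((-1 : ℤ) ^ (p / 2) * p : ℤ)) : ℚ)).IsElliptic :=
    (W.quadraticTwist ((((-1 : ℤ) ^ (p / 2) * p : ℤ)) : ℚ)).isElliptic_quadraticTwist hd0
  -- `W ∼ W₀ ⊗ p*`
  have htw' : IsIsogenous W (W₀.quadraticTwist ((((-1 : ℤ) ^ (p / 2) * p : ℤ)) : ℚ)) := by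
    obtain ⟨Cq, hCq⟩ := W.exists_variableChange_smul_eq_quadraticTwist_sq hd0
    have h1 : IsIsogenous W ((W.quadraticTwist ((((-1 : ℤ) ^ (p / 2) * p : ℤ)) : ℚ)).quadraticTwist
        ((((-1 : ℤ) ^ (p / 2) * p : ℤ)) : ℚ)) := by
      rw [quadraticTwist_quadraticTwist, ← sq, ← hCq]
      exact isIsogenous_smul _ _
    exact h1.trans' (hiso.quadraticTwist hd0)
  -- `p² ∣ N(W₀) = N(W ⊗ p*)`, and `N(W₀) = N(W)`
  have hpN₀ : p ^ 2 ∣ W₀.conductorNorm ℤ := by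
    rw [← conductorNorm_eq_of_isIsogenous_of_modularity hmod _ _ hiso]
    exact hpT
  have hNN : W₀.conductorNorm ℤ = W.conductorNorm ℤ :=
    conductorNorm_eq_of_isIsogenous_twist_pStar_of_sq_dvd hnf hp5 htw' hpN hpN₀
  -- `W₀ ⊗ p*` is additive at `p`: it is isogenous to `W`, whose conductor is divisible by `p²`
  have htw₀ : ¬ ((W₀.quadraticTwist (((-1 : ℤ) ^ (p / 2) * p : ℤ) : ℚ)).HasGoodReductionAt
          ((Rat.HeightOneSpectrum.primesEquiv (R := ℤ)).symm ⟨p, hpF.out⟩) ∨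
        (W₀.quadraticTwist (((-1 : ℤ) ^ (p / 2) * p : ℤ) : ℚ)).HasMultiplicativeReductionAt
          ((Rat.HeightOneSpectrum.primesEquiv (R := ℤ)).symm ⟨p, hpF.out⟩)) := by
    apply not_good_or_mult_at_primesEquiv_symm_of_sq_dvd_conductorNorm _ hp
    rw [← conductorNorm_eq_of_isIsogenous_of_modularity hmod _ _ htw']
    exact hpN
  -- the globally minimal model `C` of `W ⊗ p*` (`∼ W₀`): additive, `0 ≤ ord_p j`, `ord_p Δ_min ∈ {8, 4}`
  obtain ⟨u, hCmin⟩ := hasGlobalMinimalModel_rat_holds (W.quadraticTwist ((((-1 : ℤ) ^ (p / 2) * p : ℤ)) : ℚ))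
  set C : WeierstrassCurve ℚ := u • W.quadraticTwist ((((-1 : ℤ) ^ (p / 2) * p : ℤ)) : ℚ) with hCdef
  haveI : C.IsGloballyMinimal := hCmin
  have hCW₀ : IsIsogenous C W₀ :=
    (isIsogenous_smul (W.quadraticTwist ((((-1 : ℤ) ^ (p / 2) * p : ℤ)) : ℚ)) u).symm_of_charZero.trans' hiso
  have hAddC : Addv C p := by
    have hNC : C.conductorNorm ℤ = W₀.conductorNorm ℤ := conductorNorm_eq_of_isIsogenous_of_modularity hmod _ _ hCW₀
    exact not_good_and_not_mult_of_sq_dvd_conductorNorm C (by rw [hNC]; exact hpN₀)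
  have hjC : 0 ≤ padicValRat p C.j := by
    have hjCW : C.j = W.j := j_eq_of_smul_quadraticTwist_eq hd0 u hCdef.symm
    rw [hjCW]; exact hj
  have hvC' : (padicValInt p C.minimalDiscriminantInt : ℤ) =
      padicValInt p W.minimalDiscriminantInt + 6 - 12 * padicValRat p (u.u : ℚ) :=
    padicValInt_minimalDiscriminantInt_twist_pStar_eq p W C u (by rw [← hcast])
  obtain ⟨m, hm⟩ : ∃ m : ℤ, padicValRat p (u.u : ℚ) = m := ⟨_, rfl⟩
  rw [hm] at hvC'
  have hmemC := padicValInt_minimalDiscriminantInt_mem_of_addv_of_padicValRat_j_nonneg C p hp5 hAddC hjC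
  have hvC : padicValInt p C.minimalDiscriminantInt = 8 ∨ padicValInt p C.minimalDiscriminantInt = 4 := by
    rcases hvW with h | h <;> rw [h] at hvC' <;>
      rcases hmemC with h' | h' | h' | h' | h' | h' | h' <;> rw [h'] at hvC' ⊢ <;> omega
  -- tame-index invariance along `W₀ ∼ C`: `gcd(12, ord_p Δ_min(W₀)) = gcd(12, ord_p Δ_min(C)) = 4`
  obtain ⟨hadd₀, hj₀⟩ := Addv.of_isIsogenous_of_padicValRat_j_nonneg (p := p) hAddC hjC hCW₀
  have hgcd := TameDefectIsogenyInvariance.gcd_padicValInt_minimalDiscriminantInt_eq_of_isIsogenous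
    (W := W₀) (W' := C) hp5 hj₀ hCW₀.symm_of_charZero
  have h4 : Nat.gcd 12 (padicValInt p W₀.minimalDiscriminantInt) = 4 := by
    rw [← hgcd]
    rcases hvC with h | h <;> rw [h] <;> norm_num
  have h6 : padicValInt p W₀.minimalDiscriminantInt ≠ 6 := by
    intro h; rw [h] at h4; norm_num at h4
  have hI₀ := forall_kodairaSymbolAt_ne_Istar_of_padicValRat_j_nonneg_of_ne_six W₀ p hp5 hadd₀ hj₀ h6
  have hv₀ : padicValInt p W₀.minimalDiscriminantInt = 4 ∨ padicValInt p W₀.minimalDiscriminantInt = 8 := by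
    rcases kodairaSymbolAt_placeOf_cases_of_addv W₀ p hp5 hadd₀ with
      ⟨-, h⟩ | ⟨-, h⟩ | ⟨-, h⟩ | ⟨n, hn, -⟩ | ⟨-, h⟩ | ⟨-, h⟩ | ⟨-, h⟩
    · rw [h] at h4; norm_num at h4
    · rw [h] at h4; norm_num at h4
    · exact Or.inl h
    · exact absurd hn (hI₀ n)
    · exact Or.inr h
    · rw [h] at h4; norm_num at h4
    · rw [h] at h4; norm_num at h4
  -- reducibility transfers along `W ∼ W₀ ⊗ p*`
  have hred₀ : ¬ W₀.HasIrreducibleModPGaloisRep p := fun h ↦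
    not_hasIrreducibleModPGaloisRep_of_isIsogenous htw' hred
      ((hasIrreducibleModPGaloisRep_quadraticTwist_iff W₀ hd0 p).mpr h)
  exact ⟨W₀, hE₀, hM₀, hne₀, D₀, hD₀, hiso, htw', hpN₀, hNN, hred₀, htw₀, hv₀⟩

/-! ## §3 T17 `SupersingularCornerTwistTransport` (stmt-BirchSwinnertonDyer-27551) and its bundle form (stmt-27665) -/

/-- **T17 `SupersingularCornerTwistTransport` (route `TwistFamilyManinDescent`, stmt-BirchSwinnertonDyer-27551) is a THEOREM**
(signature VERBATIM; antecedents K15a `SupersingularStrongIsUnstarred` stmt-27072 and Ray57 `EisensteinRaynaudRegimeManinUnit`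
stmt-26325 consumed, the printed semistable facts carried): on the rows `ord₅ Δ_min(W) ∈ {2, 10}` with `25 ∣ N`, `W[5]`
reducible and `W ⊗ 5*` additive, the `X₀(N)`-optimal `W` has `5 ∤ c`. Level = conductor; the lattice-optimal `χ₅`-partner
`W₀` (§2) sits on `(5; 4)` or `(5; 8)`; `(5; 8)` is a K15a row of the optimal `W₀` — empty; on `(5; 4)` Ray57 gives `5 ∤ c(D₀)`
and the an-cell's one-inclusion transport `c(D) ∣ c(D₀)` (θ, `W₀` unstarred) gives `5 ∤ c(D)`. No Gealy–Klagsbrun, no degree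
identity, no flip/commute dichotomy. Conditional on OPEN items only through its own displayed antecedents; closes
stmt-27551 by name; nothing here proves K15a, Ray57, Corner57, C5, Manin's conjecture or BSD.
[cite: Stevens1989, Lemmas (5.2), (5.4)] [cite: EdixhovenManin1991, Prop. 2 and Prop. 7] [cite: SilvermanATAEC1994, IV Table 4.1] -/
theorem supersingularCornerTwistTransport_proof : SupersingularCornerTwistTransport := by
  intro hSU hRay hM hAU hC hnf W _ _ N _ D p hp hrow hpN hred htw hopt
  obtain ⟨rfl, hv⟩ := hrow
  haveI hpF : Fact (Nat.Prime 5) := ⟨hp⟩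
  obtain rfl : N = W.conductorNorm ℤ := IsNewformOf.level_eq_conductorNorm_of_exists_isNewformOf hnf D.isNewformOf
  have hvW : padicValInt 5 W.minimalDiscriminantInt = 2 ∨ padicValInt 5 W.minimalDiscriminantInt = 10 := by
    simpa using hv
  obtain ⟨W₀, hE₀, hM₀, hne₀, D₀, hD₀, -, htw', hpN₀, hNN, hred₀, htw₀, hv₀⟩ :=
    exists_optimalPartner_pStar_of_row_two_or_ten_of_twist_additive hnf (p := 5) le_rfl W hpN htw hred hvW
  haveI := hE₀
  haveI := hM₀
  haveI := hne₀
  rcases hv₀ with hv₀ | hv₀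
  · -- partner on `(5; 4)` (IV): `c(D) ∣ c(D₀)` (θ) and Ray57 on the optimal `W₀`
    have hdvd := maninConstant_dvd_of_isIsogenous_twist_pStar_of_padicValInt_lt_six (by norm_num) W₀ W D₀ D hopt hpN₀
      hNN.symm htw' (by omega)
    have h₀ := hRay hM hAU hC hnf W₀ D₀ 5 hp (Or.inl ⟨rfl, by simp [hv₀]⟩) hpN₀ hred₀ htw₀ hD₀
    exact fun h5c ↦ h₀ (h5c.trans hdvd)
  · -- partner on `(5; 8)` (IV*): a K15a row of the OPTIMAL `W₀` — empty
    have hlt := hSU W₀ D₀ 5 hp (Or.inl ⟨rfl, by simp [hv₀]⟩) hpN₀ hred₀ htw₀ hD₀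
    omega

/-- **T17's bundle form `SupersingularCornerTwistTransportOfGK` (stmt-BirchSwinnertonDyer-27665) is a THEOREM, with the
Gealy–Klagsbrun hypothesis IDLE** (critic V#85 price (1) answered the other way: the orientation T17 needs is K15a on the
twisted class, which T17 already displays). Closes stmt-27665 by name. [cite: GealyKlagsbrun2017, Thm. 1] -/
theorem supersingularCornerTwistTransportOfGK_proof : SupersingularCornerTwistTransportOfGK :=
  fun _ ↦ supersingularCornerTwistTransport_proof

end Summit.BirchSwinnertonDyer.BirchSwinnertonDyer.Theorems

end
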